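import Literature.NumberTheory.Rogawski1990.ArchOrbFamGExtMixedCornerNormalise   -- ★ p851409 (this seat): the normalised `hCm` socket; brings `slotSign_of_mem_splitChartPlaces`, `mem_splitChartPlaces_of_isIndefiniteAt`, `RegG`
import Literature.NumberTheory.Rogawski1990.ArchHCSmoothBoundedStrata            -- ★ p851185∕p851201 (LH7-p04 (g4)): `eq_of_circleExp_eq_of_mem_Ico`
import HarnessLib

/-!
# (B3-JUNCTION, MIXED CORNER) DATA AT A NORMALISED MIXED CUBE POINT — enumeration of the singular places, face ∕ scalar data, regular-set readings

Sub-problem `HC_CM` of `HodgeConjecture`, route `HCCMUnconditional`, crux H413 `stub_N9` (stmt-24833), LH3 leaf organ **O-L1d′-N** (the `(0,2)`-normalised `hCm` socket,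
★ `centralMixedJetBounds_of_normalised`): the bookkeeping the closer `…_of_mixedCorner_normalised` needs before any analysis.  THEOREMS ONLY, lane
`--supports stmt-HodgeConjecture-24833`.

* §1 `exists_enumeration_sum_elim_bijective` (GENERIC, any finite type): a decidable predicate `p` with a second decidable predicate `sc` splits `{w ∕∕ p w}` as the image of a
  bijection `Sum.elim (k ↦ ⟨e₂ℕ k.val, _⟩) (j ↦ ⟨e₁ j, _⟩) : Fin m₂ ⊕ Fin m₁ → {w ∕∕ p w}` with `sc` on the `e₂ℕ`-slots and `¬ sc` on the `e₁`-slots — the central slots are read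
  through an `ℕ`-indexed map `e₂ℕ` so that the mixed tower's types `archLocal … (e₂ℕ k.val)` are met DEFINITIONALLY by `Equiv.ofBijective`.
* §2 at a cube point `x` (`x w l ∈ [0, 2π)` off `S′`) carrying the normalisation `hnorm` of ★ p851409: a place with a noncompact coincidence which is not scalar is a
  `{0,2}`-FACE with LITERAL `x w 0 = x w 2`, `e^{i x_{w0}} ≠ e^{i x_{w1}}`, and is a split-chart place (`faceData_of_normalised`); a scalar place has literally equal angles
  (`scalar_literal_of_cube`).
* §3 readings on the `G`-regular set `RegG S′` at a compact-chart place: the face chart `(c_{w0} − c_{w2})∕2 ≠ 0` (`half_sub_ne_zero_of_mem_regG`) and the centred relabelled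
  scalar chart `l ↦ c w (τ⁻¹ l) − x w (τ⁻¹ l)` is injective (`injective_sub_relabel_of_mem_regG`).
[Shelstad1979, §4 pp. 22–25; Bouaziz1994IntegralesOrbitales, §3.1 p. 579; Rogawski1990, §8.2 p. 122.]
-/

noncomputable section

open Set Function NumberField NumberField.InfinitePlace
open Literature.NumberTheory.Automorphic Literature.NumberTheory.Automorphic.UnitaryGroup Literature.NumberTheory.Automorphic.ArchCartan
open scoped Classical

namespace Literature.NumberTheory.Rogawski1990

/-! ## §1 Enumerating a finite predicate subtype as `Fin m₂ ⊕ Fin m₁` through an `ℕ`-indexed central slot map -/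

section Enumeration

variable {W : Type*} [Fintype W]

/-- **ENUMERATION OF `{w ∕∕ p w}` AS `Fin m₂ ⊕ Fin m₁`, CENTRAL SLOTS THROUGH `ℕ`.**  For decidable predicates `p`, `sc` on a finite type and a base point `w₀` there are
`m₁ m₂`, an `ℕ`-indexed map `e₂ℕ` (the `sc`-slots of `p`, extended by `w₀`), a map `e₁ : Fin m₁ → W` (the `¬ sc`-slots of `p`) and membership proofs such that
`Sum.elim (k ↦ ⟨e₂ℕ k.val, _⟩) (j ↦ ⟨e₁ j, _⟩)` is a BIJECTION onto `{w ∕∕ p w}`; moreover `sc (e₂ℕ k)` for `k < m₂`, `¬ sc (e₁ j)`, both maps injective on their slots and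
with disjoint images. [cite: Shelstad1979, §4 p. 22] -/
theorem exists_enumeration_sum_elim_bijective (p sc : W → Prop) (w₀ : W) :
    ∃ (m₁ m₂ : ℕ) (e₂ℕ : ℕ → W) (e₁ : Fin m₁ → W) (h₂ : ∀ k : Fin m₂, p (e₂ℕ k.val)) (h₁ : ∀ j : Fin m₁, p (e₁ j)),
      Bijective (Sum.elim (fun k : Fin m₂ => (⟨e₂ℕ k.val, h₂ k⟩ : {w // p w})) (fun j : Fin m₁ => (⟨e₁ j, h₁ j⟩ : {w // p w}))) ∧
      (∀ k : Fin m₂, sc (e₂ℕ k.val)) ∧ (∀ j : Fin m₁, ¬ sc (e₁ j)) ∧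
      (∀ k k' : Fin m₂, e₂ℕ k.val = e₂ℕ k'.val → k = k') ∧ Injective e₁ ∧ (∀ (j : Fin m₁) (k : Fin m₂), e₁ j ≠ e₂ℕ k.val) := by
  set Z := {w : W // p w ∧ sc w} with hZ
  set F := {w : W // p w ∧ ¬ sc w} with hF
  set m₂ := Fintype.card Z with hm₂
  set m₁ := Fintype.card F with hm₁
  set zL : Fin m₂ ≃ Z := (Fintype.equivFin Z).symm with hzL
  set fL : Fin m₁ ≃ F := (Fintype.equivFin F).symm with hfL
  set e₂ℕ : ℕ → W := fun n => if h : n < m₂ then (zL ⟨n, h⟩).1 else w₀ with he₂ℕ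
  have he₂ : ∀ k : Fin m₂, e₂ℕ k.val = (zL k).1 := fun k => by
    simp only [he₂ℕ, dif_pos k.isLt]
  set e₁ : Fin m₁ → W := fun j => (fL j).1 with he₁
  refine ⟨m₁, m₂, e₂ℕ, e₁, fun k => by rw [he₂ k]; exact (zL k).2.1, fun j => (fL j).2.1, ⟨?_, ?_⟩, fun k => by rw [he₂ k]; exact (zL k).2.2,
    fun j => (fL j).2.2, fun k k' hkk' => ?_, fun j j' hjj' => ?_, fun j k hjk => ?_⟩
  · -- injective
    rintro (k | j) (k' | j') h <;> have h' := congrArg Subtype.val h <;> simp only [Sum.elim_inl, Sum.elim_inr] at h'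
    · rw [he₂, he₂] at h'
      exact congrArg Sum.inl (zL.injective (Subtype.ext h'))
    · rw [he₂] at h'
      exact absurd ((zL k).2.2) (by rw [h']; exact (fL j').2.2)
    · rw [he₂] at h'
      exact absurd ((zL k').2.2) (by rw [← h']; exact (fL j).2.2)
    · exact congrArg Sum.inr (fL.injective (Subtype.ext h'))
  · -- surjective
    rintro ⟨w, hw⟩
    by_cases hsc : sc w
    · refine ⟨Sum.inl (zL.symm ⟨w, hw, hsc⟩), Subtype.ext ?_⟩
      show e₂ℕ (zL.symm ⟨w, hw, hsc⟩).val = w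
      rw [he₂, Equiv.apply_symm_apply]
    · refine ⟨Sum.inr (fL.symm ⟨w, hw, hsc⟩), Subtype.ext ?_⟩
      show e₁ (fL.symm ⟨w, hw, hsc⟩) = w
      rw [he₁]
      dsimp only
      rw [Equiv.apply_symm_apply]
  · rw [he₂, he₂] at hkk'
    exact zL.injective (Subtype.ext hkk')
  · exact fL.injective (Subtype.ext hjj')
  · rw [he₂] at hjk
    exact absurd ((zL k).2.2) (by rw [← hjk]; exact (fL j).2.2)

end Enumeration

/-! ## §2 Face and scalar data at a normalised cube point -/

section CornerData

variable (L : Type) [Field L] (α : Fin 3 → L)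

/-- **FACE DATA AT A NORMALISED CUBE POINT.**  At a cube point `x` off `S′` carrying the `(0,2)`-normalisation `hnorm` of ★ `centralMixedJetBounds_of_normalised`, a compact-chart
place `w ∉ S′` with a noncompact coincidence (`e^{i x_{wi}} = e^{i x_{wj}}`, `i ≠ j`, `slotSign w i ≠ slotSign w j`) which is NOT scalar is a `{0,2}`-face: LITERALLY `x w 0 = x w 2`,
`e^{i x_{w0}} ≠ e^{i x_{w1}}`, and `w` is a split-chart place (signs `(s, s, −s)`, ★ `slotSign_of_mem_splitChartPlaces`). [cite: Shelstad1979, §4 pp. 22–25] [cite: Bouaziz1994IntegralesOrbitales, §3.1 p. 579] -/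
theorem faceData_of_normalised (hα : ∀ i, α i ≠ 0) {S' : Finset {w : InfinitePlace L // IsComplex w}}
    {x : {w : InfinitePlace L // IsComplex w} → Fin 3 → ℝ}
    (hcube : ∀ w' : {w : InfinitePlace L // IsComplex w}, w' ∉ S' → ∀ l : Fin 3, x w' l ∈ Ico 0 (2 * Real.pi))
    (hnorm : ∀ w' : {w : InfinitePlace L // IsComplex w}, w' ∉ S' → slotSign L α w' 1 ≠ slotSign L α w' 2 →
      Circle.exp (x w' 1) = Circle.exp (x w' 2) → Circle.exp (x w' 0) = Circle.exp (x w' 1))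
    {w : {w : InfinitePlace L // IsComplex w}} (hw : w ∉ S') (hreal : ∀ i, (w.1.embedding (α i)).im = 0)
    (hnc : ∃ i j : Fin 3, i ≠ j ∧ slotSign L α w i ≠ slotSign L α w j ∧ Circle.exp (x w i) = Circle.exp (x w j))
    (hnsc : ¬ ∀ l l' : Fin 3, Circle.exp (x w l) = Circle.exp (x w l')) :
    x w 0 = x w 2 ∧ Circle.exp (x w 0) ≠ Circle.exp (x w 1) ∧ w ∈ splitChartPlaces L α := by
  obtain ⟨i, j, hij, hs, hcoin⟩ := hnc
  have hind : IsIndefiniteAt (slotSign L α) w := by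
    intro hdef
    have h0 : ∀ l : Fin 3, slotSign L α w l = slotSign L α w 0 := by
      intro l
      fin_cases l
      · rfl
      · exact hdef.1.symm
      · exact hdef.2.symm.trans hdef.1.symm
    exact hs (by rw [h0 i, h0 j])
  have hwsp : w ∈ splitChartPlaces L α := mem_splitChartPlaces_of_isIndefiniteAt L α hα hreal hind
  obtain ⟨h10, h20, hne0⟩ := slotSign_of_mem_splitChartPlaces L α hα hwsp
  have hs12 : slotSign L α w 1 ≠ slotSign L α w 2 := by
    rw [h10, h20]
    intro h
    rcases hsg : slotSign L α w 0 with _ | _ | _ <;> rw [hsg] at h hne0 <;> first | exact hne0 rfl | exact absurd h (by decide)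
  -- the coincidence `e^{ix0} = e^{ix2}` and the non-coincidence `e^{ix0} ≠ e^{ix1}`
  have h01 : Circle.exp (x w 0) ≠ Circle.exp (x w 1) := by
    intro h01
    apply hnsc
    -- from `i ≠ j` nc coincidence and `e0 = e1`: all three coincide
    have hall : Circle.exp (x w 0) = Circle.exp (x w 2) := by
      have hi : i = 0 ∨ i = 1 ∨ i = 2 := by fin_cases i <;> simp
      have hj : j = 0 ∨ j = 1 ∨ j = 2 := by fin_cases j <;> simp
      rcases hi with rfl | rfl | rfl <;> rcases hj with rfl | rfl | rfl
      · exact absurd rfl hij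
      · exact absurd h10.symm hs
      · exact hcoin
      · exact absurd h10 hs
      · exact absurd rfl hij
      · exact h01.trans hcoin
      · exact hcoin.symm
      · exact h01.trans hcoin.symm
      · exact absurd rfl hij
    intro l l'
    have hl : ∀ l : Fin 3, Circle.exp (x w l) = Circle.exp (x w 0) := by
      intro l; fin_cases l
      · rfl
      · exact h01.symm
      · exact hall.symm
    rw [hl l, hl l']
  have h02 : Circle.exp (x w 0) = Circle.exp (x w 2) := by
    have hi : i = 0 ∨ i = 1 ∨ i = 2 := by fin_cases i <;> simp
    have hj : j = 0 ∨ j = 1 ∨ j = 2 := by fin_cases j <;> simp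
    rcases hi with rfl | rfl | rfl <;> rcases hj with rfl | rfl | rfl
    · exact absurd rfl hij
    · exact absurd h10.symm hs
    · exact hcoin
    · exact absurd h10 hs
    · exact absurd rfl hij
    · exact absurd (hnorm w hw hs12 hcoin) h01
    · exact hcoin.symm
    · exact absurd (hnorm w hw hs12 hcoin.symm) h01
    · exact absurd rfl hij
  exact ⟨eq_of_circleExp_eq_of_mem_Ico h02 (hcube w hw 0) (hcube w hw 2), h01, hwsp⟩

/-- **SCALAR DATA AT A CUBE POINT**: a place `w ∉ S′` with all three eigenvalues `e^{i x_{wl}}` equal has LITERALLY equal angles (the cube `[0, 2π)`, ★ `eq_of_circleExp_eq_of_mem_Ico`).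
[cite: Shelstad1979, §4 p. 22] -/
theorem scalar_literal_of_cube {S' : Finset {w : InfinitePlace L // IsComplex w}} {x : {w : InfinitePlace L // IsComplex w} → Fin 3 → ℝ}
    (hcube : ∀ w' : {w : InfinitePlace L // IsComplex w}, w' ∉ S' → ∀ l : Fin 3, x w' l ∈ Ico 0 (2 * Real.pi))
    {w : {w : InfinitePlace L // IsComplex w}} (hw : w ∉ S') (hsc : ∀ l l' : Fin 3, Circle.exp (x w l) = Circle.exp (x w l')) :
    ∀ l l' : Fin 3, x w l = x w l' := fun l l' =>
  eq_of_circleExp_eq_of_mem_Ico (hsc l l') (hcube w hw l) (hcube w hw l')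

end CornerData

/-! ## §3 Readings on the `G`-regular set -/

section Regular

variable {W : Type*}

/-- On `RegG S′`, at a compact-chart place `w ∉ S′`, the face chart `(c_{w0} − c_{w2})∕2` does not vanish. [cite: Shelstad1979, §4 p. 22] -/
theorem half_sub_ne_zero_of_mem_regG (S' : Finset W) {w : W} (hw : w ∉ S') {c : W → Fin 3 → ℝ} (hc : c ∈ RegG S') :
    (c w 0 - c w 2) / 2 ≠ 0 := by
  intro h
  have h02 : c w 0 = c w 2 := by linarith
  have hinj : Injective fun i : Fin 3 => Circle.exp (c w i) := hc.1 w hw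
  have : (0 : Fin 3) = 2 := hinj (by simp only [h02])
  exact absurd this (by decide)

/-- On `RegG S′`, at a compact-chart place `w ∉ S′` where the base point `x` is literally scalar, the centred relabelled angle triple `l ↦ c w (τ⁻¹ l) − x w (τ⁻¹ l)` is injective
(J1's `hθreg`). [cite: Shelstad1979, §4 p. 22] [cite: Varadarajan1977, Part I §1.12] -/
theorem injective_sub_relabel_of_mem_regG (S' : Finset W) {w : W} (hw : w ∉ S') {x : W → Fin 3 → ℝ} (hxw : ∀ l l' : Fin 3, x w l = x w l')
    (τ : Equiv.Perm (Fin 3)) {c : W → Fin 3 → ℝ} (hc : c ∈ RegG S') :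
    Injective fun l : Fin 3 => c w (τ.symm l) - x w (τ.symm l) := by
  intro k k' hkk'
  have hinj : Injective fun i : Fin 3 => Circle.exp (c w i) := hc.1 w hw
  have h' : c w (τ.symm k) = c w (τ.symm k') := by
    have := hkk'
    simp only at this
    rw [hxw (τ.symm k) (τ.symm k')] at this
    linarith
  exact τ.symm.injective (hinj (by simp only [h']))

end Regular

end Literature.NumberTheory.Rogawski1990

end
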